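import Summits.Ventures.LatticeQCDFlow.Scoring.SpecialUnitaryGaussSecondMoment
import HarnessLib

/-!
# The fourth moment of the `SU(N)` Gaussian–Vandermonde law on the hyperplane: `∫ (Σ_bφ_b(ψ)²)² e^{−Σφ_b(ψ)²/2} Π_{j≺k}(φ_j(ψ) − φ_k(ψ))² dψ = (N²−1)(N²+1) · M^{SU}_N`, by scaling

HONEST FRAMING: exact (Metropolis-corrected) sampling algorithms for lattice gauge theory;
figures of merit are autocorrelation/cost numbers at stated couplings and volumes; no
continuum-physics claim.

Venture `LatticeQCDFlow` (cell pub-lqcd), sub-topic `Scoring`; FANOUT row 5 (`s0-sun-a`), GEN-20.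
NEW WORK of the cell (placement rule).  The `SU(N)` twin of `GaussVandermondeFourthMoment`, input of the weak-coupling law
of the `SU(N)` PLAQUETTE VARIANCE (`β² Var_β(Re tr U_p) → (N²−1)/2`, sibling file `PlaquetteVarianceWeakCouplingSU`).  In
GEN-17's free phases `ψ : {i ≠ i₀} → ℝ`, `φ_{i₀} = −Σψ`, with `M^{SU} = ∫ e^{−Σ_bφ_b(ψ)²/2} Π_{j≺k}(φ_j(ψ) − φ_k(ψ))² dψ`
(GEN-20 `SpecialUnitaryLaplace`) and the second moment `(N²−1) M^{SU}` (`SpecialUnitaryGaussSecondMoment`):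

* `sq_sum_phase_sq_le`;
* **`integral_normSq_suGaussVandermonde_scale`** — `∫ (Σ_bφ_b(ψ)²) e^{−tΣφ_b(ψ)²/2} Δ² dψ = (N²−1) M^{SU} / √t^{N²+1}` (`t > 0`);
* **`integral_normSq_sq_suGaussVandermonde`** — `∫ (Σ_bφ_b(ψ)²)² e^{−Σφ_b(ψ)²/2} Δ² dψ = (N²−1)(N²+1) · M^{SU}_N`:
  under the normalised law `Σ_bφ_b²/2` has mean `(N²−1)/2` and variance `(N²−1)/2` (`N² − 1 = dim SU(N)`).

No `def`, nothing cited as a fact, 0 sorry.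
-/

noncomputable section

open Real MeasureTheory Filter Topology Finset
open Literature.RepresentationTheory.CompactGroups.WeylIntegration (OD enum)

namespace Summit.Ventures.LatticeQCDFlow.Scoring

section SU4

variable {n : Type*} [Fintype n] [DecidableEq n] (i₀ : n)

/-- `(Σ_b φ_b(ψ)²)² ≤ (1 + |m|)² (Π_k (1 + ψ_k²))²`. -/
theorem sq_sum_phase_sq_le (ψ : {i : n // i ≠ i₀} → ℝ) :
    (∑ b : n, (if h : b = i₀ then -∑ k, ψ k else ψ ⟨b, h⟩ : ℝ) ^ 2) ^ 2
      ≤ ((1 + Fintype.card {i : n // i ≠ i₀}) * ∏ k : {i : n // i ≠ i₀}, (1 + ψ k ^ 2)) ^ 2 :=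
  pow_le_pow_left₀ (Finset.sum_nonneg fun b _ => sq_nonneg (if h : b = i₀ then -∑ k, ψ k else ψ ⟨b, h⟩ : ℝ)) (sum_phase_sq_le i₀ ψ) 2

/-- **First-moment scaling law on the hyperplane**:
`∫ (Σ_bφ_b(ψ)²) e^{−tΣφ_b(ψ)²/2} Π(φ_j(ψ) − φ_k(ψ))² dψ = (N² − 1) · M^{SU} / √t^{N²+1}` (`t > 0`). -/
theorem integral_normSq_suGaussVandermonde_scale {t : ℝ} (ht : 0 < t) :
    ∫ ψ : {i : n // i ≠ i₀} → ℝ, (∑ b : n, (if h : b = i₀ then -∑ k, ψ k else ψ ⟨b, h⟩ : ℝ) ^ 2) * (Real.exp (∑ b : n, -(t * (if h : b = i₀ then -∑ k, ψ k else ψ ⟨b, h⟩ : ℝ) ^ 2 / 2)) *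
        ∏ p : OD n, ((if h : p.1.1 = i₀ then -∑ k, ψ k else ψ ⟨p.1.1, h⟩ : ℝ) - (if h : p.1.2 = i₀ then -∑ k, ψ k else ψ ⟨p.1.2, h⟩ : ℝ)) ^ 2)
      = ((Fintype.card n : ℝ) ^ 2 - 1) *
          (∫ ψ : {i : n // i ≠ i₀} → ℝ, Real.exp (∑ b : n, -((if h : b = i₀ then -∑ k, ψ k else ψ ⟨b, h⟩ : ℝ) ^ 2 / 2)) *
          ∏ p : OD n, ((if h : p.1.1 = i₀ then -∑ k, ψ k else ψ ⟨p.1.1, h⟩ : ℝ) - (if h : p.1.2 = i₀ then -∑ k, ψ k else ψ ⟨p.1.2, h⟩ : ℝ)) ^ 2) / √t ^ (Fintype.card n ^ 2 + 1) := by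
  have hs : 0 < √t := Real.sqrt_pos.2 ht
  set M : ℝ := (∫ ψ : {i : n // i ≠ i₀} → ℝ, Real.exp (∑ b : n, -((if h : b = i₀ then -∑ k, ψ k else ψ ⟨b, h⟩ : ℝ) ^ 2 / 2)) *
          ∏ p : OD n, ((if h : p.1.1 = i₀ then -∑ k, ψ k else ψ ⟨p.1.1, h⟩ : ℝ) - (if h : p.1.2 = i₀ then -∑ k, ψ k else ψ ⟨p.1.2, h⟩ : ℝ)) ^ 2) with hM
  set G : ({i : n // i ≠ i₀} → ℝ) → ℝ := fun ψ => (∑ b : n, (if h : b = i₀ then -∑ k, ψ k else ψ ⟨b, h⟩ : ℝ) ^ 2) * (Real.exp (∑ b : n, -((if h : b = i₀ then -∑ k, ψ k else ψ ⟨b, h⟩ : ℝ) ^ 2 / 2)) *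
    ∏ p : OD n, ((if h : p.1.1 = i₀ then -∑ k, ψ k else ψ ⟨p.1.1, h⟩ : ℝ) - (if h : p.1.2 = i₀ then -∑ k, ψ k else ψ ⟨p.1.2, h⟩ : ℝ)) ^ 2) with hG
  have hGint : ∫ ψ, G ψ = ((Fintype.card n : ℝ) ^ 2 - 1) * M := integral_normSq_suGaussVandermonde i₀
  have hpt : ∀ ψ : {i : n // i ≠ i₀} → ℝ, G (√t • ψ)
      = t * √t ^ (2 * Fintype.card (OD n)) * ((∑ b : n, (if h : b = i₀ then -∑ k, ψ k else ψ ⟨b, h⟩ : ℝ) ^ 2) * (Real.exp (∑ b : n, -(t * (if h : b = i₀ then -∑ k, ψ k else ψ ⟨b, h⟩ : ℝ) ^ 2 / 2)) *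
          ∏ p : OD n, ((if h : p.1.1 = i₀ then -∑ k, ψ k else ψ ⟨p.1.1, h⟩ : ℝ) - (if h : p.1.2 = i₀ then -∑ k, ψ k else ψ ⟨p.1.2, h⟩ : ℝ)) ^ 2)) := by
    intro ψ
    simp only [hG, phase_smul]
    have h0 : ∑ b : n, (√t * (if h : b = i₀ then -∑ k, ψ k else ψ ⟨b, h⟩ : ℝ)) ^ 2 = t * ∑ b : n, (if h : b = i₀ then -∑ k, ψ k else ψ ⟨b, h⟩ : ℝ) ^ 2 := by
      rw [Finset.mul_sum]
      refine Finset.sum_congr rfl fun b _ => ?_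
      rw [mul_pow, Real.sq_sqrt ht.le]
    have h1 : ∑ b : n, -((√t * (if h : b = i₀ then -∑ k, ψ k else ψ ⟨b, h⟩ : ℝ)) ^ 2 / 2) = ∑ b : n, -(t * (if h : b = i₀ then -∑ k, ψ k else ψ ⟨b, h⟩ : ℝ) ^ 2 / 2) := by
      refine Finset.sum_congr rfl fun b _ => ?_
      rw [mul_pow, Real.sq_sqrt ht.le]
    have h2 : ∏ p : OD n, (√t * (if h : p.1.1 = i₀ then -∑ k, ψ k else ψ ⟨p.1.1, h⟩ : ℝ) - √t * (if h : p.1.2 = i₀ then -∑ k, ψ k else ψ ⟨p.1.2, h⟩ : ℝ)) ^ 2 = √t ^ (2 * Fintype.card (OD n)) *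
        ∏ p : OD n, ((if h : p.1.1 = i₀ then -∑ k, ψ k else ψ ⟨p.1.1, h⟩ : ℝ) - (if h : p.1.2 = i₀ then -∑ k, ψ k else ψ ⟨p.1.2, h⟩ : ℝ)) ^ 2 := by
      have hc : ∏ _p : OD n, √t ^ 2 = √t ^ (2 * Fintype.card (OD n)) := by
        rw [Finset.prod_const, Finset.card_univ, ← pow_mul, mul_comm]
      rw [← hc, ← Finset.prod_mul_distrib]
      exact Finset.prod_congr rfl fun p _ => by ring
    rw [h0, h1, h2]
    ring
  have hcomp := Measure.integral_comp_smul volume G (√t)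
  rw [Module.finrank_fintype_fun_eq_card, smul_eq_mul] at hcomp
  simp_rw [hpt] at hcomp
  rw [integral_const_mul, hGint] at hcomp
  have h1N : 1 ≤ Fintype.card n := Fintype.card_pos_iff.2 ⟨i₀⟩
  have hcard : Fintype.card n ^ 2 + 1 = Fintype.card {i : n // i ≠ i₀} + 2 * Fintype.card (OD n) + 2 := by
    have h := card_ne_add_two_mul_card_OD i₀
    have h1 : 1 ≤ Fintype.card n ^ 2 := Nat.one_le_pow 2 _ h1N
    omega
  have habs : |(√t ^ Fintype.card {i : n // i ≠ i₀})⁻¹| = (√t ^ Fintype.card {i : n // i ≠ i₀})⁻¹ :=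
    abs_of_pos (by positivity)
  rw [habs] at hcomp
  have ht2 : √t ^ 2 = t := Real.sq_sqrt ht.le
  rw [hcard, pow_add, pow_add, ht2, eq_div_iff (by positivity)]
  calc (∫ ψ : {i : n // i ≠ i₀} → ℝ, (∑ b : n, (if h : b = i₀ then -∑ k, ψ k else ψ ⟨b, h⟩ : ℝ) ^ 2) * (Real.exp (∑ b : n, -(t * (if h : b = i₀ then -∑ k, ψ k else ψ ⟨b, h⟩ : ℝ) ^ 2 / 2)) *
          ∏ p : OD n, ((if h : p.1.1 = i₀ then -∑ k, ψ k else ψ ⟨p.1.1, h⟩ : ℝ) - (if h : p.1.2 = i₀ then -∑ k, ψ k else ψ ⟨p.1.2, h⟩ : ℝ)) ^ 2)) *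
        (√t ^ Fintype.card {i : n // i ≠ i₀} * √t ^ (2 * Fintype.card (OD n)) * t)
      = (t * √t ^ (2 * Fintype.card (OD n)) * ∫ ψ : {i : n // i ≠ i₀} → ℝ, (∑ b : n, (if h : b = i₀ then -∑ k, ψ k else ψ ⟨b, h⟩ : ℝ) ^ 2) * (Real.exp (∑ b : n, -(t * (if h : b = i₀ then -∑ k, ψ k else ψ ⟨b, h⟩ : ℝ) ^ 2 / 2)) *
          ∏ p : OD n, ((if h : p.1.1 = i₀ then -∑ k, ψ k else ψ ⟨p.1.1, h⟩ : ℝ) - (if h : p.1.2 = i₀ then -∑ k, ψ k else ψ ⟨p.1.2, h⟩ : ℝ)) ^ 2)) * √t ^ Fintype.card {i : n // i ≠ i₀} := by ring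
    _ = (√t ^ Fintype.card {i : n // i ≠ i₀})⁻¹ * (((Fintype.card n : ℝ) ^ 2 - 1) * M) * √t ^ Fintype.card {i : n // i ≠ i₀} := by
          rw [hcomp]
    _ = ((Fintype.card n : ℝ) ^ 2 - 1) * M := by field_simp

/-- **`∫ (Σ_bφ_b(ψ)²)² e^{−Σφ_b(ψ)²/2} Π(φ_j(ψ) − φ_k(ψ))² dψ = (N² − 1)(N² + 1) · M^{SU}_N`**: differentiate the
first-moment scaling law on the hyperplane at `t = 1` under the integral sign. -/
theorem integral_normSq_sq_suGaussVandermonde :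
    ∫ ψ : {i : n // i ≠ i₀} → ℝ, (∑ b : n, (if h : b = i₀ then -∑ k, ψ k else ψ ⟨b, h⟩ : ℝ) ^ 2) ^ 2 * (Real.exp (∑ b : n, -((if h : b = i₀ then -∑ k, ψ k else ψ ⟨b, h⟩ : ℝ) ^ 2 / 2)) *
        ∏ p : OD n, ((if h : p.1.1 = i₀ then -∑ k, ψ k else ψ ⟨p.1.1, h⟩ : ℝ) - (if h : p.1.2 = i₀ then -∑ k, ψ k else ψ ⟨p.1.2, h⟩ : ℝ)) ^ 2)
      = ((Fintype.card n : ℝ) ^ 2 - 1) * ((Fintype.card n : ℝ) ^ 2 + 1) *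
        (∫ ψ : {i : n // i ≠ i₀} → ℝ, Real.exp (∑ b : n, -((if h : b = i₀ then -∑ k, ψ k else ψ ⟨b, h⟩ : ℝ) ^ 2 / 2)) *
          ∏ p : OD n, ((if h : p.1.1 = i₀ then -∑ k, ψ k else ψ ⟨p.1.1, h⟩ : ℝ) - (if h : p.1.2 = i₀ then -∑ k, ψ k else ψ ⟨p.1.2, h⟩ : ℝ)) ^ 2) := by
  set M : ℝ := (∫ ψ : {i : n // i ≠ i₀} → ℝ, Real.exp (∑ b : n, -((if h : b = i₀ then -∑ k, ψ k else ψ ⟨b, h⟩ : ℝ) ^ 2 / 2)) *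
          ∏ p : OD n, ((if h : p.1.1 = i₀ then -∑ k, ψ k else ψ ⟨p.1.1, h⟩ : ℝ) - (if h : p.1.2 = i₀ then -∑ k, ψ k else ψ ⟨p.1.2, h⟩ : ℝ)) ^ 2) with hM
  set F : ℝ → ({i : n // i ≠ i₀} → ℝ) → ℝ := fun t ψ => (∑ b : n, (if h : b = i₀ then -∑ k, ψ k else ψ ⟨b, h⟩ : ℝ) ^ 2) * (Real.exp (∑ b : n, -(t * (if h : b = i₀ then -∑ k, ψ k else ψ ⟨b, h⟩ : ℝ) ^ 2 / 2)) *
    ∏ p : OD n, ((if h : p.1.1 = i₀ then -∑ k, ψ k else ψ ⟨p.1.1, h⟩ : ℝ) - (if h : p.1.2 = i₀ then -∑ k, ψ k else ψ ⟨p.1.2, h⟩ : ℝ)) ^ 2) with hF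
  set F' : ℝ → ({i : n // i ≠ i₀} → ℝ) → ℝ := fun t ψ => -((∑ b : n, (if h : b = i₀ then -∑ k, ψ k else ψ ⟨b, h⟩ : ℝ) ^ 2) / 2) * ((∑ b : n, (if h : b = i₀ then -∑ k, ψ k else ψ ⟨b, h⟩ : ℝ) ^ 2) * (Real.exp (∑ b : n, -(t * (if h : b = i₀ then -∑ k, ψ k else ψ ⟨b, h⟩ : ℝ) ^ 2 / 2)) *
    ∏ p : OD n, ((if h : p.1.1 = i₀ then -∑ k, ψ k else ψ ⟨p.1.1, h⟩ : ℝ) - (if h : p.1.2 = i₀ then -∑ k, ψ k else ψ ⟨p.1.2, h⟩ : ℝ)) ^ 2)) with hF'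
  have hphc : ∀ b : n, Continuous fun ψ : {i : n // i ≠ i₀} → ℝ => (if h : b = i₀ then -∑ k, ψ k else ψ ⟨b, h⟩ : ℝ) := fun b => continuous_ext_apply i₀ b
  have hSc : Continuous fun ψ : {i : n // i ≠ i₀} → ℝ => (∑ b : n, (if h : b = i₀ then -∑ k, ψ k else ψ ⟨b, h⟩ : ℝ) ^ 2) := continuous_finsetSum _ fun b _ => (hphc b).pow 2
  have hRc : ∀ t : ℝ, Continuous fun ψ : {i : n // i ≠ i₀} → ℝ => Real.exp (∑ b : n, -(t * (if h : b = i₀ then -∑ k, ψ k else ψ ⟨b, h⟩ : ℝ) ^ 2 / 2)) *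
      ∏ p : OD n, ((if h : p.1.1 = i₀ then -∑ k, ψ k else ψ ⟨p.1.1, h⟩ : ℝ) - (if h : p.1.2 = i₀ then -∑ k, ψ k else ψ ⟨p.1.2, h⟩ : ℝ)) ^ 2 := fun t =>
    (Real.continuous_exp.comp (continuous_finsetSum _ fun b _ => ((continuous_const.mul
      ((hphc b).pow 2)).div_const _).neg)).mul (continuous_finsetProd _ fun p _ => ((hphc _).sub (hphc _)).pow 2)
  have hcont : ∀ t, Continuous (F t) := fun t => by
    simp only [hF]
    exact hSc.mul (hRc t)
  have hcont' : ∀ t, Continuous (F' t) := fun t => by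
    simp only [hF']
    exact ((hSc.div_const _).neg).mul (hSc.mul (hRc t))
  have hderiv : ∀ ψ : {i : n // i ≠ i₀} → ℝ, ∀ t : ℝ, HasDerivAt (fun s => F s ψ) (F' t ψ) t := by
    intro ψ t
    simp only [hF, hF']
    have h1 : HasDerivAt (fun s : ℝ => ∑ b : n, -(s * (if h : b = i₀ then -∑ k, ψ k else ψ ⟨b, h⟩ : ℝ) ^ 2 / 2)) (-((∑ b : n, (if h : b = i₀ then -∑ k, ψ k else ψ ⟨b, h⟩ : ℝ) ^ 2)) / 2) t := by
      have e : (fun s : ℝ => ∑ b : n, -(s * (if h : b = i₀ then -∑ k, ψ k else ψ ⟨b, h⟩ : ℝ) ^ 2 / 2)) = fun s => s * ∑ b : n, -((if h : b = i₀ then -∑ k, ψ k else ψ ⟨b, h⟩ : ℝ) ^ 2 / 2) := by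
        funext s; rw [Finset.mul_sum]; exact Finset.sum_congr rfl fun b _ => by ring
      have hK : ∑ b : n, -((if h : b = i₀ then -∑ k, ψ k else ψ ⟨b, h⟩ : ℝ) ^ 2 / 2) = -((∑ b : n, (if h : b = i₀ then -∑ k, ψ k else ψ ⟨b, h⟩ : ℝ) ^ 2)) / 2 := by
        rw [Finset.sum_neg_distrib, neg_div, Finset.sum_div]
      rw [e, ← hK]
      have h := (hasDerivAt_id' t).mul_const (∑ b : n, -((if h : b = i₀ then -∑ k, ψ k else ψ ⟨b, h⟩ : ℝ) ^ 2 / 2))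
      rwa [one_mul] at h
    have h2 := (h1.exp.mul_const (∏ p : OD n, ((if h : p.1.1 = i₀ then -∑ k, ψ k else ψ ⟨p.1.1, h⟩ : ℝ) - (if h : p.1.2 = i₀ then -∑ k, ψ k else ψ ⟨p.1.2, h⟩ : ℝ)) ^ 2)).const_mul (∑ b : n, (if h : b = i₀ then -∑ k, ψ k else ψ ⟨b, h⟩ : ℝ) ^ 2)
    refine h2.congr_deriv ?_
    ring
  -- domination for `t ∈ (1/2, 3/2)`
  have hbound : ∀ ψ : {i : n // i ≠ i₀} → ℝ, ∀ t ∈ Set.Ioo (1 / 2 : ℝ) (3 / 2), ‖F' t ψ‖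
      ≤ ((1 + Fintype.card {i : n // i ≠ i₀}) ^ 2 * (4 * Fintype.card {i : n // i ≠ i₀}) ^ Fintype.card (OD n)) *
        ∏ k : {i : n // i ≠ i₀}, (Real.exp (-(2 / π ^ 2 * ψ k ^ 2)) * (1 + ψ k ^ 2) ^ (Fintype.card (OD n) + 2)) := by
    intro ψ t ht
    simp only [hF', Real.norm_eq_abs]
    have hS0 : 0 ≤ (∑ b : n, (if h : b = i₀ then -∑ k, ψ k else ψ ⟨b, h⟩ : ℝ) ^ 2) := Finset.sum_nonneg fun b _ => sq_nonneg _
    have hR0 : 0 ≤ Real.exp (∑ b : n, -(t * (if h : b = i₀ then -∑ k, ψ k else ψ ⟨b, h⟩ : ℝ) ^ 2 / 2)) *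
        ∏ p : OD n, ((if h : p.1.1 = i₀ then -∑ k, ψ k else ψ ⟨p.1.1, h⟩ : ℝ) - (if h : p.1.2 = i₀ then -∑ k, ψ k else ψ ⟨p.1.2, h⟩ : ℝ)) ^ 2 :=
      mul_nonneg (Real.exp_nonneg _) (Finset.prod_nonneg fun p _ => sq_nonneg _)
    rw [show -((∑ b : n, (if h : b = i₀ then -∑ k, ψ k else ψ ⟨b, h⟩ : ℝ) ^ 2) / 2) * ((∑ b : n, (if h : b = i₀ then -∑ k, ψ k else ψ ⟨b, h⟩ : ℝ) ^ 2) * (Real.exp (∑ b : n, -(t * (if h : b = i₀ then -∑ k, ψ k else ψ ⟨b, h⟩ : ℝ) ^ 2 / 2)) *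
        ∏ p : OD n, ((if h : p.1.1 = i₀ then -∑ k, ψ k else ψ ⟨p.1.1, h⟩ : ℝ) - (if h : p.1.2 = i₀ then -∑ k, ψ k else ψ ⟨p.1.2, h⟩ : ℝ)) ^ 2)) = -(((∑ b : n, (if h : b = i₀ then -∑ k, ψ k else ψ ⟨b, h⟩ : ℝ) ^ 2) ^ 2 / 2) * (Real.exp (∑ b : n, -(t * (if h : b = i₀ then -∑ k, ψ k else ψ ⟨b, h⟩ : ℝ) ^ 2 / 2)) *
        ∏ p : OD n, ((if h : p.1.1 = i₀ then -∑ k, ψ k else ψ ⟨p.1.1, h⟩ : ℝ) - (if h : p.1.2 = i₀ then -∑ k, ψ k else ψ ⟨p.1.2, h⟩ : ℝ)) ^ 2)) by ring, abs_neg, abs_of_nonneg (mul_nonneg (by positivity) hR0)]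
    have hexp : Real.exp (∑ b : n, -(t * (if h : b = i₀ then -∑ k, ψ k else ψ ⟨b, h⟩ : ℝ) ^ 2 / 2)) ≤ ∏ k : {i : n // i ≠ i₀}, Real.exp (-(2 / π ^ 2 * ψ k ^ 2)) := by
      rw [← Real.exp_sum]
      refine Real.exp_le_exp.2 ?_
      have hπ : 2 / π ^ 2 ≤ 1 / 4 := by
        rw [div_le_div_iff₀ (by positivity) (by norm_num)]
        nlinarith [Real.pi_gt_three]
      have hQ := sum_sq_le_sum_phase_sq i₀ ψ
      have e1 : ∑ b : n, -(t * (if h : b = i₀ then -∑ k, ψ k else ψ ⟨b, h⟩ : ℝ) ^ 2 / 2) = -(t / 2) * (∑ b : n, (if h : b = i₀ then -∑ k, ψ k else ψ ⟨b, h⟩ : ℝ) ^ 2) := by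
        rw [Finset.mul_sum]; exact Finset.sum_congr rfl fun b _ => by ring
      have e2 : ∑ k : {i : n // i ≠ i₀}, -(2 / π ^ 2 * ψ k ^ 2) = -(2 / π ^ 2) * ∑ k, ψ k ^ 2 := by
        rw [Finset.mul_sum]; exact Finset.sum_congr rfl fun k _ => by ring
      rw [e1, e2]
      have h0 : 0 ≤ ∑ k, ψ k ^ 2 := Finset.sum_nonneg fun k _ => sq_nonneg _
      nlinarith [ht.1, mul_le_mul_of_nonneg_left hQ (show (0:ℝ) ≤ t/2 by linarith [ht.1])]
    have hmain := mul_prod_le_suBound i₀ ψ hexp (fun p => sq_nonneg _) (fun p => le_rfl)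
    have hsum : (∑ b : n, (if h : b = i₀ then -∑ k, ψ k else ψ ⟨b, h⟩ : ℝ) ^ 2) ^ 2 / 2 ≤ ((1 + Fintype.card {i : n // i ≠ i₀}) * ∏ k : {i : n // i ≠ i₀}, (1 + ψ k ^ 2)) ^ 2 := by
      have h := sq_sum_phase_sq_le i₀ ψ
      have h0 : 0 ≤ (∑ b : n, (if h : b = i₀ then -∑ k, ψ k else ψ ⟨b, h⟩ : ℝ) ^ 2) ^ 2 := sq_nonneg _
      linarith
    calc (∑ b : n, (if h : b = i₀ then -∑ k, ψ k else ψ ⟨b, h⟩ : ℝ) ^ 2) ^ 2 / 2 * (Real.exp (∑ b : n, -(t * (if h : b = i₀ then -∑ k, ψ k else ψ ⟨b, h⟩ : ℝ) ^ 2 / 2)) *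
          ∏ p : OD n, ((if h : p.1.1 = i₀ then -∑ k, ψ k else ψ ⟨p.1.1, h⟩ : ℝ) - (if h : p.1.2 = i₀ then -∑ k, ψ k else ψ ⟨p.1.2, h⟩ : ℝ)) ^ 2)
        ≤ ((1 + Fintype.card {i : n // i ≠ i₀}) * ∏ k : {i : n // i ≠ i₀}, (1 + ψ k ^ 2)) ^ 2 *
          ((4 * Fintype.card {i : n // i ≠ i₀}) ^ Fintype.card (OD n) *
            ∏ k : {i : n // i ≠ i₀}, (Real.exp (-(2 / π ^ 2 * ψ k ^ 2)) * (1 + ψ k ^ 2) ^ Fintype.card (OD n))) :=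
          mul_le_mul hsum hmain hR0 (by positivity)
      _ = ((1 + Fintype.card {i : n // i ≠ i₀}) ^ 2 * (4 * Fintype.card {i : n // i ≠ i₀}) ^ Fintype.card (OD n)) *
          ∏ k : {i : n // i ≠ i₀}, (Real.exp (-(2 / π ^ 2 * ψ k ^ 2)) * (1 + ψ k ^ 2) ^ (Fintype.card (OD n) + 2)) := by
          rw [mul_pow, show ∀ a b c d : ℝ, (a * b) * (c * d) = (a * c) * (b * d) from fun a b c d => by ring,
            ← Finset.prod_pow, ← Finset.prod_mul_distrib]
          congr 1
          exact Finset.prod_congr rfl fun k _ => by ring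
  have hint1 : Integrable (F 1) := by
    refine Integrable.mono' (integrable_gaussPolyBound ((1 + Fintype.card {i : n // i ≠ i₀}) *
      (4 * Fintype.card {i : n // i ≠ i₀}) ^ Fintype.card (OD n)) (Fintype.card (OD n) + 1))
      (hcont 1).aestronglyMeasurable (Eventually.of_forall fun ψ => ?_)
    simp only [hF]
    have hS0 : 0 ≤ (∑ b : n, (if h : b = i₀ then -∑ k, ψ k else ψ ⟨b, h⟩ : ℝ) ^ 2) := Finset.sum_nonneg fun b _ => sq_nonneg _
    have hR0 : 0 ≤ Real.exp (∑ b : n, -(1 * (if h : b = i₀ then -∑ k, ψ k else ψ ⟨b, h⟩ : ℝ) ^ 2 / 2)) *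
        ∏ p : OD n, ((if h : p.1.1 = i₀ then -∑ k, ψ k else ψ ⟨p.1.1, h⟩ : ℝ) - (if h : p.1.2 = i₀ then -∑ k, ψ k else ψ ⟨p.1.2, h⟩ : ℝ)) ^ 2 :=
      mul_nonneg (Real.exp_nonneg _) (Finset.prod_nonneg fun p _ => sq_nonneg _)
    rw [Real.norm_eq_abs, abs_of_nonneg (mul_nonneg hS0 hR0)]
    have hexp : Real.exp (∑ b : n, -(1 * (if h : b = i₀ then -∑ k, ψ k else ψ ⟨b, h⟩ : ℝ) ^ 2 / 2)) ≤ ∏ k : {i : n // i ≠ i₀}, Real.exp (-(2 / π ^ 2 * ψ k ^ 2)) := by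
      rw [← Real.exp_sum]
      refine Real.exp_le_exp.2 ?_
      have hQ := sum_sq_le_sum_phase_sq i₀ ψ
      have e1 : ∑ b : n, -(1 * (if h : b = i₀ then -∑ k, ψ k else ψ ⟨b, h⟩ : ℝ) ^ 2 / 2) = -(1 / 2) * (∑ b : n, (if h : b = i₀ then -∑ k, ψ k else ψ ⟨b, h⟩ : ℝ) ^ 2) := by
        rw [Finset.mul_sum]; exact Finset.sum_congr rfl fun b _ => by ring
      have e2 : ∑ k : {i : n // i ≠ i₀}, -(2 / π ^ 2 * ψ k ^ 2) = -(2 / π ^ 2) * ∑ k, ψ k ^ 2 := by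
        rw [Finset.mul_sum]; exact Finset.sum_congr rfl fun k _ => by ring
      rw [e1, e2]
      have hπ : 2 / π ^ 2 ≤ 1 / 2 := by
        rw [div_le_div_iff₀ (by positivity) (by norm_num)]
        nlinarith [Real.pi_gt_three]
      have h0 : 0 ≤ ∑ k, ψ k ^ 2 := Finset.sum_nonneg fun k _ => sq_nonneg _
      nlinarith
    have hmain := mul_prod_le_suBound i₀ ψ hexp (fun p => sq_nonneg _) (fun p => le_rfl)
    calc (∑ b : n, (if h : b = i₀ then -∑ k, ψ k else ψ ⟨b, h⟩ : ℝ) ^ 2) * (Real.exp (∑ b : n, -(1 * (if h : b = i₀ then -∑ k, ψ k else ψ ⟨b, h⟩ : ℝ) ^ 2 / 2)) *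
          ∏ p : OD n, ((if h : p.1.1 = i₀ then -∑ k, ψ k else ψ ⟨p.1.1, h⟩ : ℝ) - (if h : p.1.2 = i₀ then -∑ k, ψ k else ψ ⟨p.1.2, h⟩ : ℝ)) ^ 2)
        ≤ ((1 + Fintype.card {i : n // i ≠ i₀}) * ∏ k : {i : n // i ≠ i₀}, (1 + ψ k ^ 2)) *
          ((4 * Fintype.card {i : n // i ≠ i₀}) ^ Fintype.card (OD n) *
            ∏ k : {i : n // i ≠ i₀}, (Real.exp (-(2 / π ^ 2 * ψ k ^ 2)) * (1 + ψ k ^ 2) ^ Fintype.card (OD n))) :=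
          mul_le_mul (sum_phase_sq_le i₀ ψ) hmain hR0 (by positivity)
      _ = ((1 + Fintype.card {i : n // i ≠ i₀}) * (4 * Fintype.card {i : n // i ≠ i₀}) ^ Fintype.card (OD n)) *
          ∏ k : {i : n // i ≠ i₀}, (Real.exp (-(2 / π ^ 2 * ψ k ^ 2)) * (1 + ψ k ^ 2) ^ (Fintype.card (OD n) + 1)) := by
          rw [show ∀ a b c d : ℝ, (a * b) * (c * d) = (a * c) * (b * d) from fun a b c d => by ring, ← Finset.prod_mul_distrib]
          congr 1
          exact Finset.prod_congr rfl fun k _ => by ring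
  have hD := hasDerivAt_integral_of_dominated_loc_of_deriv_le (μ := (volume : Measure ({i : n // i ≠ i₀} → ℝ)))
    (x₀ := (1 : ℝ)) (F := F) (F' := F') (s := Set.Ioo (1 / 2 : ℝ) (3 / 2)) (Ioo_mem_nhds (by norm_num) (by norm_num))
    (Eventually.of_forall fun t => (hcont t).aestronglyMeasurable) hint1 (hcont' 1).aestronglyMeasurable
    (Eventually.of_forall fun ψ t ht => hbound ψ t ht) (integrable_gaussPolyBound _ _)
    (Eventually.of_forall fun ψ t _ => hderiv ψ t)
  have hscale : ∀ᶠ t : ℝ in 𝓝 1, ∫ ψ, F t ψ =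
      ((Fintype.card n : ℝ) ^ 2 - 1) * M * (t ^ (-(((Fintype.card n : ℝ) ^ 2 + 1) / 2))) := by
    filter_upwards [Ioo_mem_nhds (show (1 / 2 : ℝ) < 1 by norm_num) (show (1 : ℝ) < 3 / 2 by norm_num)] with t ht
    have ht0 : 0 < t := by linarith [ht.1]
    show (∫ ψ : {i : n // i ≠ i₀} → ℝ, (∑ b : n, (if h : b = i₀ then -∑ k, ψ k else ψ ⟨b, h⟩ : ℝ) ^ 2) * (Real.exp (∑ b : n, -(t * (if h : b = i₀ then -∑ k, ψ k else ψ ⟨b, h⟩ : ℝ) ^ 2 / 2)) *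
      ∏ p : OD n, ((if h : p.1.1 = i₀ then -∑ k, ψ k else ψ ⟨p.1.1, h⟩ : ℝ) - (if h : p.1.2 = i₀ then -∑ k, ψ k else ψ ⟨p.1.2, h⟩ : ℝ)) ^ 2)) = _
    have hpow : √t ^ (Fintype.card n ^ 2 + 1) = t ^ (((Fintype.card n : ℝ) ^ 2 + 1) / 2) := by
      rw [Real.sqrt_eq_rpow, ← Real.rpow_natCast, ← Real.rpow_mul ht0.le]
      congr 1
      push_cast
      ring
    rw [integral_normSq_suGaussVandermonde_scale i₀ ht0, hM.symm, hpow, Real.rpow_neg ht0.le, div_eq_mul_inv]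
  have hD2 : HasDerivAt (fun t : ℝ => ∫ ψ, F t ψ)
      (((Fintype.card n : ℝ) ^ 2 - 1) * M * (-(((Fintype.card n : ℝ) ^ 2 + 1) / 2))) 1 := by
    have h := (Real.hasDerivAt_rpow_const (x := (1 : ℝ)) (p := -(((Fintype.card n : ℝ) ^ 2 + 1) / 2))
      (Or.inl one_ne_zero)).const_mul (((Fintype.card n : ℝ) ^ 2 - 1) * M)
    simp only [Real.one_rpow, mul_one] at h
    exact h.congr_of_eventuallyEq hscale
  have huniq := hD.2.unique hD2
  have hF'1 : ∫ ψ, F' 1 ψ = -(1 / 2) * ∫ ψ : {i : n // i ≠ i₀} → ℝ, (∑ b : n, (if h : b = i₀ then -∑ k, ψ k else ψ ⟨b, h⟩ : ℝ) ^ 2) ^ 2 * (Real.exp (∑ b : n, -((if h : b = i₀ then -∑ k, ψ k else ψ ⟨b, h⟩ : ℝ) ^ 2 / 2)) *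
      ∏ p : OD n, ((if h : p.1.1 = i₀ then -∑ k, ψ k else ψ ⟨p.1.1, h⟩ : ℝ) - (if h : p.1.2 = i₀ then -∑ k, ψ k else ψ ⟨p.1.2, h⟩ : ℝ)) ^ 2) := by
    rw [← integral_const_mul]
    refine integral_congr_ae (Eventually.of_forall fun ψ => ?_)
    simp only [hF', one_mul]
    ring
  rw [hF'1] at huniq
  have : ∫ ψ : {i : n // i ≠ i₀} → ℝ, (∑ b : n, (if h : b = i₀ then -∑ k, ψ k else ψ ⟨b, h⟩ : ℝ) ^ 2) ^ 2 * (Real.exp (∑ b : n, -((if h : b = i₀ then -∑ k, ψ k else ψ ⟨b, h⟩ : ℝ) ^ 2 / 2)) *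
      ∏ p : OD n, ((if h : p.1.1 = i₀ then -∑ k, ψ k else ψ ⟨p.1.1, h⟩ : ℝ) - (if h : p.1.2 = i₀ then -∑ k, ψ k else ψ ⟨p.1.2, h⟩ : ℝ)) ^ 2) = ((Fintype.card n : ℝ) ^ 2 - 1) * ((Fintype.card n : ℝ) ^ 2 + 1) * M := by linarith
  rw [this]

end SU4

end Summit.Ventures.LatticeQCDFlow.Scoring
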